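import Summits.ValiantsHypothesis.ValiantsHypothesis.Theorems.NewtonUnitEquationsTwoProductsRankOneOneSidedLawCount
import HarnessLib

/-!
# Route NewtonUnitEquations — crux `TwoProducts` (stmt-ValiantsHypothesis-5906), line `relation_ladder`, rung R8 (ONE-SIDED rank one
# `p•α = Σ_i q_i•β_i`, any number of plus letters): the DILATED FREE LIFT with a plus-letter SET — part 6/6 — wide plus sides are permutation type; the arithmetic; THE LAW `rankOneOneSidedLaw_proof` (T8 end)

Part 6: `support_msetT_subset`, `card_support_msetT_le`, **`permType_of_rankOne_wide`** (`#supp ρ⁺ > m + #supp ρ⁻ ⇒` permutation type);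
`NmO_add_two_le/lt`, `logNmO_le`, `sqlogO_le`, `powNmO_le`, `arith_R8` (`c = 1732`); ★ **`rankOneOneSidedLaw_proof`** = the literal body of
val-idea-8 g3's typed `R8.RankOneOneSidedLaw` with the predicate `R8.OneSidedRankOne` unfolded (the typed law closes by `:= R8.rankOneOneSidedLaw_proof`, δ only).

THE ONE-SIDED RANK-ONE LAW `p•α = Σ_{i<k} q_i•β_i` (R8; all `p, q_i ≥ 1`, distinct letters, every additive coincidence of the letter
family a multiple of this one relation): GLOBALLY `#visible ≤ 2^{c m}(#T + 2)^c` (`c = 1732`).  Engine (val-idea-8 g3's memo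
`Cruxes/TwoProducts/Lines/relation_ladder_R8_engine.md` rev 2, typed target `Lines/relation_ladder_sketch_R8.lean :: R8.RankOneOneSidedLaw`,
slice count `Lines/relation_ladder_R8_simplex.lean` = landed `…RankOneSimplexCount`): the DILATED FREE LIFT `α ↦ ∏ Y_j^{q_j}`, `Y_j ↦ Y_j^p` on
the plus letters, identity elsewhere, over the `p`-dilated plane (`enumP : j ↦ enum j` on the plus letters, `i ↦ p•enum i` otherwise); fibres
`k = #α` with divisibility guards `p ∣ x_j − q_j k`; letter count `B_k = k + Σ_j (x_j − q_j k)/p`; SLICING by the whole plus-letter exponent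
vector `b = x|_B`; the coefficient theorem with `Pfac · C(R + B_k − 1, B_k) · κ_k`; finite SHIFT RANK `2m(Σb + 1)² + 1` and val-lit-p3's
`ShiftRank.pencilCount` BY NAME; the slices of the visible points factor through the restricted letter multisets `L₀|_{a ∪ B}` (`deg L₀ ≤ m`),
counted by the simplex bound `#W ≤ 2^{n+k}` (`R8.card_W_le`); WIDE plus sides (`k > m + 1`), large (`> m`) or absent coefficients/letters are
permutation type (R3♯).  `k = 1` is R7c (`R7b.rankOneTwoLaw_proof`), `k = 2` is R7b (`R7b.rankOneThreeGenLaw_proof`).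

AUTHORSHIP / LANE NOTE (val-lit-p3 g15, prover seat, helper mode `--supports stmt-ValiantsHypothesis-5906 --as helper`; CLAIM-FIRST #2 on the
val-lit bus 12:55Z, silence = GO 13:30Z, no objection; the line owner val-idea-8 g3 CLOSED 12:24Z leaving R8 as a typed target + memo): part 6/6.
The STATEMENT is val-idea-8 g3's typed `R8.RankOneOneSidedLaw` (landed here by its LITERAL BODY, `OneSidedRankOne` unfolded — parameter-free
`def … : Prop` are not declared in Theorems files); the engine follows g3's memo decl-by-decl as a generalisation of the landed R7b REV 2 port
(`…RankOneThreeGenLaw*`, namespace `R7b`); the Lean text of this module is this seat's.  Reused BY NAME: `R6b.HSD` (+ closure lemmas),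
`R7b.dilE`/`R7b.piT_dilE`/`R7b.piE_dilE`, `R7a.permType_of_rankOne_largeCoeff/absent`, `toolBound_mono`, `tab`, `sgn`, `R6b.sum_sgn`,
`PlanarCell.eq_of_nsmul_eq`, `FormalLogLinearisation.wt_nsmul`, `R8.card_W_le` (simplex).  Namespace `…PermutationType.R8` (the typed target's).
Nothing here closes the line's residual (`ResidualLawV20`), the crux `TwoProducts` (5906) or `VP ≠ VNP`; no summit statement is proved.

Honest scope: TWO-SIDED relations with ≥ 2 letters on each side (e.g. `α+2β = γ+δ`, val-neg-1 g4's p635912) and coincidence rank ≥ 2 are NOT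
covered.  Nothing here moves VP ≠ VNP; `TwoProducts` (5906) / `PlanarCellBound` stay OPEN. [folklore]

Cut table (this seat's scratch `HOME/lmr/staged/p3g15-R8/R8-Scratch.lean`, 1 798 lines, rc 0 / 0 warnings / 0 sorries): part 1 `…Free`
= T2–T3 (`OIdx`, `frM`, `xhat`, `Lof`, `Adm`/`KR`, `Bk`; bookkeeping choice, the only deviation from the memo: the plus side is a coefficient FUNCTION
`qf : σ → ℕ` with `B = {qf ≠ 0}`, no `Fin k` families inside the engine — the typed `(β, q) : Fin k → …` data are met only in the law); part 2 `…Slice` = `Pfac`, `kap`, `multinomial_Lof_eq`, `coeff_phiT_frM`, T4 slice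
functions and THE COEFFICIENT THEOREM `coeff_free_logTrunc`; part 3 `…SliceExc` = the exceptional point, `mem_support_free_logTrunc_iff`,
`xOf`, `Fsl_congr`; part 4 `…ShiftPlanar` = T5 `Fsl_shift` + T7 `RelDataO`, `enumP`, injectivity, lifted visible points, letter weights;
part 5 `…Count` = T8 `sliceMin_of_visible`, `card_le_of_supported`, `sliceCount`, `RelDataO.count`; part 6 `…Law` = wide ⇒ permutation type,
arithmetic (`c = 1732`), `rankOneOneSidedLaw_proof`.
-/

noncomputable section

-- Sub = Summit single-conjunct layout: the duplicated namespace component is mandated by the tree.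
set_option linter.dupNamespace false
set_option linter.unusedSimpArgs false
set_option linter.unusedSectionVars false
set_option linter.unusedVariables false

namespace Summit.ValiantsHypothesis.ValiantsHypothesis.Theorems.NewtonUnitEquations.TwoProducts.PermutationType
namespace R8
open scoped BigOperators
open MvPolynomial

variable {σ : Type*} [Fintype σ] [DecidableEq σ]

section FreeCount
open Summit.ValiantsHypothesis.ValiantsHypothesis.Theorems.NewtonUnitEquations.TwoProducts.FormalLogLinearisation
open Summit.ValiantsHypothesis.ValiantsHypothesis.Theorems.NewtonUnitEquations.TwoProducts.PlanarCell

variable {m : ℕ}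

/-! ### Degenerate relation data are permutation type: a WIDE plus side -/

/-- The letter multiset of a `0`-filled tuple is supported on the letters of the tuple. [folklore] -/
theorem support_msetT_subset (a : Fin m → Expo) : (msetT a).support ⊆ Finset.univ.image a := by
  classical
  intro e he
  unfold msetT at he
  obtain ⟨j, -, hj⟩ := Finset.mem_biUnion.mp (Finsupp.support_finsetSum he)
  rw [Finset.mem_image]
  refine ⟨j, Finset.mem_univ _, ?_⟩
  by_cases h0 : a j = 0
  · rw [if_pos h0] at hj; simp at hj
  · rw [if_neg h0] at hj
    exact (Finset.mem_singleton.mp (Finsupp.support_single_subset hj)).symm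

/-- The letter multiset of a `0`-filled tuple of length `m` has at most `m` distinct letters. [folklore] -/
theorem card_support_msetT_le (a : Fin m → Expo) : (msetT a).support.card ≤ m :=
  (Finset.card_le_card (support_msetT_subset a)).trans (Finset.card_image_le.trans (by simp))

/-- **Wide relations are permutation type.** If the coincidences are rank one with relation `ρ⁺ ~ ρ⁻` and one side has more than
`m + #supp(other side)` letters, every coincidence has multiplier `0`: the family is of permutation type. [folklore] -/
theorem permType_of_rankOne_wide (A : Fin m → Finset Expo) (ρp ρm : Expo →₀ ℕ) (h : RankOneCoincidences A ρp ρm)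
    (hw : m + ρm.support.card < ρp.support.card ∨ m + ρp.support.card < ρm.support.card) : PermType A := by
  classical
  have main : ∀ (ρ ρ' : Expo →₀ ℕ), m + ρ'.support.card < ρ.support.card → ∀ k : ℕ, 0 < k →
      ∀ c c' : Fin m → Expo, msetT c + k • ρ ≠ msetT c' + k • ρ' := by
    intro ρ ρ' hlt k hk c c' heq
    have hsub : ρ.support ⊆ (msetT c + k • ρ).support := fun e he => by
      rw [Finsupp.mem_support_iff] at he ⊢
      simp only [Finsupp.add_apply, Finsupp.smul_apply, smul_eq_mul]
      have : 0 < k * ρ e := Nat.mul_pos hk (Nat.pos_of_ne_zero he)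
      omega
    have hsup : (msetT c' + k • ρ').support.card ≤ m + ρ'.support.card :=
      calc (msetT c' + k • ρ').support.card ≤ ((msetT c').support ∪ (k • ρ').support).card :=
            Finset.card_le_card Finsupp.support_add
        _ ≤ (msetT c').support.card + (k • ρ').support.card := Finset.card_union_le _ _
        _ ≤ m + ρ'.support.card :=
            Nat.add_le_add (card_support_msetT_le c') (Finset.card_le_card Finsupp.support_smul)
    have h2 : (msetT c + k • ρ).support.card ≤ m + ρ'.support.card := by rw [heq]; exact hsup
    have := (Finset.card_le_card hsub).trans h2
    omega
  intro a ha b hb hab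
  obtain ⟨k, hk⟩ := h a ha b hb hab
  rcases Nat.eq_zero_or_pos k with rfl | hk0
  · rcases hk with hk | hk
    · simpa using hk
    · simpa using hk.symm
  · exfalso
    rcases hw with hw | hw
    · rcases hk with hk | hk
      · exact main ρp ρm hw k hk0 a b hk
      · exact main ρp ρm hw k hk0 b a hk
    · rcases hk with hk | hk
      · exact main ρm ρp hw k hk0 b a hk.symm
      · exact main ρm ρp hw k hk0 a b hk.symm

/-! ### The arithmetic (no `ring` on numeral powers of `s + 2`) -/

/-- `N_m + 2 ≤ 8 (m+1)^7`. [folklore] -/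
theorem NmO_add_two_le (m : ℕ) : NmO m + 2 ≤ 8 * (m + 1) ^ 7 := by
  unfold NmO
  have h1 : m * m * (m + 1) + 1 ≤ (m + 1) ^ 3 := by
    have e : (m + 1) ^ 3 = m * m * (m + 1) + 1 + (2 * (m * m) + 3 * m) := by ring
    rw [e]; omega
  have h2 : (m * m * (m + 1) + 1) ^ 2 ≤ ((m + 1) ^ 3) ^ 2 := Nat.pow_le_pow_left h1 2
  have e3 : ((m + 1) ^ 3) ^ 2 = (m + 1) ^ 6 := by ring
  rw [e3] at h2
  have h4 : 2 * m * (m * m * (m + 1) + 1) ^ 2 ≤ 2 * (m + 1) * (m + 1) ^ 6 :=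
    Nat.mul_le_mul (by omega) h2
  have e5 : 8 * (m + 1) ^ 7 = 2 * (m + 1) * (m + 1) ^ 6 + 6 * (m + 1) ^ 7 := by ring
  have h6 : 1 ≤ (m + 1) ^ 7 := Nat.one_le_pow _ _ (by omega)
  rw [e5]
  omega

/-- `N_m + 2 < 2^(7 log₂(m+1) + 10)`. [folklore] -/
theorem NmO_add_two_lt (m : ℕ) : NmO m + 2 < 2 ^ (7 * Nat.log 2 (m + 1) + 10) := by
  have hp1 : m + 1 < 2 ^ (Nat.log 2 (m + 1) + 1) := Nat.lt_pow_succ_log_self (by norm_num) (m + 1)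
  have h5 : (m + 1) ^ 7 < (2 ^ (Nat.log 2 (m + 1) + 1)) ^ 7 := Nat.pow_lt_pow_left hp1 (by norm_num)
  have e3 : 8 * (2 ^ (Nat.log 2 (m + 1) + 1)) ^ 7 = 2 ^ (7 * Nat.log 2 (m + 1) + 10) := by
    rw [← pow_mul, show (8 : ℕ) = 2 ^ 3 by norm_num, ← pow_add]
    congr 1
    ring
  have h1 := NmO_add_two_le m
  have h8 : 8 * (m + 1) ^ 7 < 8 * (2 ^ (Nat.log 2 (m + 1) + 1)) ^ 7 := Nat.mul_lt_mul_of_pos_left h5 (by norm_num)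
  omega

/-- `log₂(N_m + 2) + 1 ≤ 7 log₂(m+1) + 10`. [folklore] -/
theorem logNmO_le (m : ℕ) : Nat.log 2 (NmO m + 2) + 1 ≤ 7 * Nat.log 2 (m + 1) + 10 := by
  have := Nat.log_lt_of_lt_pow (by omega : NmO m + 2 ≠ 0) (NmO_add_two_lt m)
  omega

/-- `(7 log₂(m+1) + 10)² ≤ 576 m` for `m ≥ 1`. [folklore] -/
theorem sqlogO_le (m : ℕ) (hm : 1 ≤ m) :
    (7 * Nat.log 2 (m + 1) + 10) * (7 * Nat.log 2 (m + 1) + 10) ≤ 576 * m := by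
  have hp2 : 2 ^ Nat.log 2 (m + 1) ≤ m + 1 := Nat.pow_log_le_self 2 (by omega)
  have hpp : Nat.log 2 (m + 1) < 2 ^ Nat.log 2 (m + 1) := Nat.lt_two_pow_self
  have hp3 : Nat.log 2 (m + 1) * Nat.log 2 (m + 1) ≤ 2 ^ (Nat.log 2 (m + 1) + 1) := sq_le_two_pow_succ _
  have h2p : 2 ^ (Nat.log 2 (m + 1) + 1) = 2 * 2 ^ Nat.log 2 (m + 1) := pow_succ' 2 _
  have e4 : (7 * Nat.log 2 (m + 1) + 10) * (7 * Nat.log 2 (m + 1) + 10) =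
      49 * (Nat.log 2 (m + 1) * Nat.log 2 (m + 1)) + 140 * Nat.log 2 (m + 1) + 100 := by ring
  rw [e4]
  omega

/-- `(N_m + 2)^(3 (log₂(N_m + 2) + 1)) ≤ 2^(1728 m)` for `m ≥ 1`. [folklore] -/
theorem powNmO_le (m : ℕ) (hm : 1 ≤ m) : (NmO m + 2) ^ (3 * (Nat.log 2 (NmO m + 2) + 1)) ≤ 2 ^ (1728 * m) := by
  have hN2 := NmO_add_two_lt m
  have hL := logNmO_le m
  have hq := sqlogO_le m hm
  calc (NmO m + 2) ^ (3 * (Nat.log 2 (NmO m + 2) + 1))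
      ≤ (2 ^ (7 * Nat.log 2 (m + 1) + 10)) ^ (3 * (Nat.log 2 (NmO m + 2) + 1)) := Nat.pow_le_pow_left hN2.le _
    _ ≤ (2 ^ (7 * Nat.log 2 (m + 1) + 10)) ^ (3 * (7 * Nat.log 2 (m + 1) + 10)) :=
        Nat.pow_le_pow_right (by positivity) (Nat.mul_le_mul_left _ hL)
    _ = 2 ^ (3 * ((7 * Nat.log 2 (m + 1) + 10) * (7 * Nat.log 2 (m + 1) + 10))) := by
        rw [← pow_mul]
        congr 1
        ring
    _ ≤ 2 ^ (1728 * m) := Nat.pow_le_pow_right (by norm_num) (by omega)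

set_option exponentiation.threshold 2048 in
/-- **Arithmetic**: `2^{2m+2} · sliceBdO ≤ 2^{c m} (s+2)^c` and `2^{13m}(s+2)^2 ≤ 2^{c m}(s+2)^c` with `c = 1732`. [folklore] -/
theorem arith_R8 : ∃ c : ℕ,
    (∀ m s : ℕ, 1 ≤ m → 2 ^ (2 * m + 2) * sliceBdO m s ≤ 2 ^ (c * m) * (s + 2) ^ c) ∧
    (∀ m s : ℕ, 2 ^ (13 * m) * (s + 2) ^ 2 ≤ 2 ^ (c * m) * (s + 2) ^ c) := by
  refine ⟨1732, fun m s hm => ?_, fun m s => ?_⟩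
  · have hsA : (s + 2) ^ 3 ≤ (s + 2) ^ 1732 := Nat.pow_le_pow_right (by omega) (by norm_num)
    have hpow := powNmO_le m hm
    have h4 : 2 ^ (2 * m + 2) ≤ 2 ^ (4 * m) := Nat.pow_le_pow_right (by norm_num) (by omega)
    have h2m : 2 ^ (4 * m) * 2 ^ (1728 * m) ≤ 2 ^ (1732 * m) := by
      rw [← pow_add]
      exact Nat.pow_le_pow_right (by norm_num) (by omega)
    unfold sliceBdO
    calc 2 ^ (2 * m + 2) * ((s + 2) ^ 3 * (NmO m + 2) ^ (3 * (Nat.log 2 (NmO m + 2) + 1)))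
        ≤ 2 ^ (4 * m) * ((s + 2) ^ 1732 * 2 ^ (1728 * m)) := Nat.mul_le_mul h4 (Nat.mul_le_mul hsA hpow)
      _ = 2 ^ (4 * m) * 2 ^ (1728 * m) * (s + 2) ^ 1732 := by
          rw [Nat.mul_comm ((s + 2) ^ 1732) (2 ^ (1728 * m)), ← Nat.mul_assoc]
      _ ≤ 2 ^ (1732 * m) * (s + 2) ^ 1732 := Nat.mul_le_mul_right _ h2m
  · exact Nat.mul_le_mul (Nat.pow_le_pow_right (by norm_num) (by omega))
      (Nat.pow_le_pow_right (by omega) (by norm_num))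

/-! ### The law -/

/-- **R8 — the ONE-SIDED rank-one law, PROVED UNCONDITIONALLY** (literal body of val-idea-8 g3's typed `R8.RankOneOneSidedLaw`,
`Lines/relation_ladder_sketch_R8.lean`, with the predicate `R8.OneSidedRankOne` unfolded; close the typed law by `:= rankOneOneSidedLaw_proof`):
if ALL additive coincidences of the letter family come from ONE relation `p • α = Σ_{i<k} q_i • β_i` (distinct letters, `p, q_i ≥ 1`),
then GLOBALLY `#visible ≤ 2^{c m} (#T + 2)^c` (`c = 1732`).  Lift `α ↦ ∏ β_i^{q_i}, β_i ↦ β_i^p` over the `p`-dilated plane + toric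
Lemma A + slicing by the plus-letter exponents with divisibility guards + coefficient theorem + finite shift rank + val-lit-p3's
`ShiftRank.pencilCount`; slices through the simplex `#W ≤ 2^{n+k}`; wide (`k > m+1`), large or absent coefficients are permutation
type.  `k = 1` is R7c (`R7b.rankOneTwoLaw_proof`), `k = 2` is R7b (`R7b.rankOneThreeGenLaw_proof`). [folklore] -/
theorem rankOneOneSidedLaw_proof : ∃ c : ℕ, ∀ (m : ℕ) (u v : Fin m → MvPolynomial (Fin 2) ℂ),
    (∀ j, coeff 0 (u j) = 0) → (∀ j, coeff 0 (v j) = 0) →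
    (∃ (α : Expo) (p k : ℕ) (β : Fin k → Expo) (q : Fin k → ℕ), 1 ≤ p ∧ 1 ≤ k ∧ (∀ i, 1 ≤ q i) ∧ Function.Injective β ∧
      (∀ i, β i ≠ α) ∧ p • α = ∑ i, q i • β i ∧
      RankOneCoincidences (fun j => (u j).support ∪ (v j).support) (∑ i, Finsupp.single (β i) (q i)) (Finsupp.single α p)) →
    ∀ S : Finset Expo, (∀ l ∈ S, ∃ ξ : Fin 2 → ℝ, ValidWeight u v ξ ∧ IsStrictTop ξ ↑(tailDiff u v).support l) →
      S.card ≤ 2 ^ (c * m) * ((tailSupport u v).card + 2) ^ c := by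
  classical
  obtain ⟨c, hc1, hc2⟩ := arith_R8
  refine ⟨c, fun m u v hu hv hone S hS => ?_⟩
  obtain ⟨α, p, k, β, q, hp, hk, hq, hβinj, hβα, hrel, hR⟩ := hone
  rcases S.eq_empty_or_nonempty with hSe | hSne
  · simp [hSe]
  obtain ⟨l₀, hl₀⟩ := hSne
  obtain ⟨ξ₀, hval₀, htop₀⟩ := hS l₀ hl₀
  have hm : 1 ≤ m := by
    rcases Nat.eq_zero_or_pos m with h | h
    · exfalso
      subst h
      apply mem_support_iff.mp htop₀.1
      unfold tailDiff
      simp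
    · exact h
  set A : Fin m → Finset Expo := fun j => (u j).support ∪ (v j).support with hA
  set ρp : Expo →₀ ℕ := ∑ i, Finsupp.single (β i) (q i) with hρpdef
  set ρm : Expo →₀ ℕ := Finsupp.single α p with hρmdef
  -- evaluations and supports of the two sides of the relation
  have hρp_apply : ∀ e, ρp e = ∑ i, if β i = e then q i else 0 := fun e => by
    rw [hρpdef, Finsupp.finsetSum_apply]
    simp only [Finsupp.single_apply]
  have hρp_β : ∀ i, ρp (β i) = q i := fun i => by
    rw [hρp_apply, Finset.sum_eq_single i (fun j _ hji => if_neg (fun h => hji (hβinj h)))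
      (fun h => absurd (Finset.mem_univ i) h), if_pos rfl]
  have hρp_zero_of : ∀ e, (∀ i, β i ≠ e) → ρp e = 0 := fun e he => by
    rw [hρp_apply]; exact Finset.sum_eq_zero fun i _ => if_neg (he i)
  have hρp_α : ρp α = 0 := hρp_zero_of α hβα
  have hρm_α : ρm α = p := by rw [hρmdef, Finsupp.single_eq_same]
  have hρm_β : ∀ i, ρm (β i) = 0 := fun i => by rw [hρmdef, Finsupp.single_apply, if_neg (hβα i).symm]
  have hsupp_p : ρp.support = Finset.univ.image β := by
    ext e
    rw [Finsupp.mem_support_iff, Finset.mem_image]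
    constructor
    · intro h
      by_contra hne
      apply h
      apply hρp_zero_of e
      intro i hi
      exact hne ⟨i, Finset.mem_univ _, hi⟩
    · rintro ⟨i, -, rfl⟩
      rw [hρp_β]; have := hq i; omega
  have hcard_p : ρp.support.card = k := by
    rw [hsupp_p, Finset.card_image_of_injective _ hβinj, Finset.card_univ, Fintype.card_fin]
  have hcard_m : ρm.support.card = 1 := by
    rw [hρmdef, Finsupp.support_single _ (by omega : p ≠ 0), Finset.card_singleton]
  have hPT : PermType A → S.card ≤ 2 ^ (c * m) * ((tailSupport u v).card + 2) ^ c := fun hperm =>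
    calc S.card ≤ 2 ^ (13 * m) * ((tailSupport u v).card + 2) ^ 2 := permTypeLaw_proof m u v hu hv hperm S hS
      _ ≤ 2 ^ (c * m) * ((tailSupport u v).card + 2) ^ c := hc2 m _
  -- a wide plus side: permutation type
  by_cases hwide : m + 1 < k
  · apply hPT
    exact permType_of_rankOne_wide A ρp ρm hR (Or.inl (by rw [hcard_p, hcard_m]; exact hwide))
  have hkm : k ≤ m + 1 := by omega
  -- a coefficient exceeds `m`: permutation type
  by_cases hlarge : (∃ i, m < q i) ∨ m < p
  · apply hPT
    rcases hlarge with ⟨i, hi⟩ | hpl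
    · exact R7a.permType_of_rankOne_largeCoeff A ρp ρm (β i) hR (Or.inl ⟨by rw [hρp_β]; exact hi, hρm_β i⟩)
    · exact R7a.permType_of_rankOne_largeCoeff A ρp ρm α hR (Or.inr ⟨by rw [hρm_α]; exact hpl, hρp_α⟩)
  have hqm : ∀ i, q i ≤ m := fun i => by
    by_contra h; exact hlarge (Or.inl ⟨i, by omega⟩)
  have hpm : p ≤ m := by
    by_contra h; exact hlarge (Or.inr (by omega))
  by_cases hall : α ∈ tailSupport u v ∧ ∀ i, β i ∈ tailSupport u v
  · -- the non-degenerate case: all letters in the alphabet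
    obtain ⟨hαT, hβT⟩ := hall
    set qI : Fin (sE u v) → ℕ := fun j => ∑ i, if β i = enum u v j then q i else 0 with hqI
    have hqI_β : ∀ i, qI (idxOf u v (β i) (hβT i)) = q i := fun i => by
      rw [hqI]
      simp only
      rw [enum_idxOf, Finset.sum_eq_single i (fun j _ hji => if_neg (fun h => hji (hβinj h)))
        (fun h => absurd (Finset.mem_univ i) h), if_pos rfl]
    have hqI_zero : ∀ j, (∀ i, β i ≠ enum u v j) → qI j = 0 := fun j hj => by
      rw [hqI]; exact Finset.sum_eq_zero fun i _ => if_neg (hj i)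
    have hqI_cases : ∀ j, qI j = 0 ∨ ∃ i, β i = enum u v j ∧ qI j = q i := fun j => by
      by_cases h : ∃ i, β i = enum u v j
      · obtain ⟨i, hi⟩ := h
        right
        refine ⟨i, hi, ?_⟩
        have : j = idxOf u v (β i) (hβT i) := by apply enum_injective u v; rw [enum_idxOf, hi]
        rw [this, hqI_β]
      · left
        push Not at h
        exact hqI_zero j h
    have hqa : qI (idxOf u v α hαT) = 0 := hqI_zero _ fun i => by rw [enum_idxOf]; exact hβα i
    have hne : ∃ j, qI j ≠ 0 := ⟨idxOf u v (β ⟨0, hk⟩) (hβT _), by rw [hqI_β]; have := hq ⟨0, hk⟩; omega⟩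
    have hrel' : p • α = ∑ j, qI j • enum u v j := by
      rw [hrel]
      have key : ∀ i, q i • β i = ∑ j, (if β i = enum u v j then q i else 0) • enum u v j := fun i => by
        rw [Finset.sum_eq_single (idxOf u v (β i) (hβT i))]
        · rw [enum_idxOf, if_pos rfl]
        · intro j _ hj
          have hne' : ¬ β i = enum u v j := by
            intro h; apply hj; apply enum_injective u v; rw [enum_idxOf, ← h]
          rw [if_neg hne', zero_smul]
        · intro h; exact absurd (Finset.mem_univ _) h
      rw [Finset.sum_congr rfl fun i _ => key i, Finset.sum_comm]
      refine Finset.sum_congr rfl fun j _ => ?_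
      rw [hqI]
      simp only
      rw [Finset.sum_smul]
    let D : RelDataO u v := ⟨α, p, hp, hαT, qI, hqa, hne, hrel'⟩
    have hrho : D.rhoP = ρp := by
      ext e
      change (Finsupp.mapDomain (enum u v) (ofFun qI)) e = ρp e
      by_cases he : ∃ j, enum u v j = e
      · obtain ⟨j, rfl⟩ := he
        rw [Finsupp.mapDomain_apply (enum_injective u v), ofFun_apply, hρp_apply, hqI]
      · have hn : e ∉ Set.range (enum u v) := fun ⟨j, hj⟩ => he ⟨j, hj⟩
        have hz : ∀ i, β i ≠ e := fun i h => he ⟨idxOf u v (β i) (hβT i), by rw [enum_idxOf, h]⟩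
        rw [Finsupp.mapDomain_notin_range _ _ hn, hρp_zero_of e hz]
    have hqm' : ∀ j, D.qI j ≤ m := fun j => by
      change qI j ≤ m
      rcases hqI_cases j with h | ⟨i, -, h⟩
      · rw [h]; exact Nat.zero_le _
      · rw [h]; exact hqm i
    have hBm : (B D.idx).card ≤ m + 1 := by
      have hsub : B D.idx ⊆ Finset.univ.image fun i => idxOf u v (β i) (hβT i) := by
        intro j hj
        have hj' : qI j ≠ 0 := (mem_B D.idx j).1 hj
        rcases hqI_cases j with h | ⟨i, hi, -⟩
        · exact absurd h hj'
        · rw [Finset.mem_image]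
          refine ⟨i, Finset.mem_univ _, ?_⟩
          apply enum_injective u v; rw [enum_idxOf, hi]
      calc (B D.idx).card ≤ (Finset.univ.image fun i => idxOf u v (β i) (hβT i)).card := Finset.card_le_card hsub
        _ ≤ (Finset.univ : Finset (Fin k)).card := Finset.card_image_le
        _ = k := by rw [Finset.card_univ, Fintype.card_fin]
        _ ≤ m + 1 := hkm
    have hR' : RankOneCoincidences A D.rhoP (Finsupp.single D.α D.p) := by rw [hrho]; exact hR
    exact (D.count hu hv hqm' hpm hBm hR' S hS).trans (hc1 m (sE u v) hm)
  · -- an absent relation letter: permutation type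
    apply hPT
    have hex : ∃ e : Expo, (e = α ∨ ∃ i, e = β i) ∧ e ∉ tailSupport u v := by
      by_cases hαT : α ∈ tailSupport u v
      · have h' : ¬ ∀ i, β i ∈ tailSupport u v := fun h => hall ⟨hαT, h⟩
        push Not at h'
        obtain ⟨i, hi⟩ := h'
        exact ⟨β i, Or.inr ⟨i, rfl⟩, hi⟩
      · exact ⟨α, Or.inl rfl, hαT⟩
    obtain ⟨e, he, hnot⟩ := hex
    have hnotj : ∀ j, e ∉ (u j).support ∪ (v j).support := by
      intro j hj
      apply hnot
      rcases Finset.mem_union.mp hj with h | h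
      · exact support_u_subset u v j h
      · exact support_v_subset u v j h
    rcases he with rfl | ⟨i, rfl⟩
    · exact R7a.permType_of_rankOne_absent A ρp ρm _ hR (Or.inr ⟨by rw [hρm_α]; exact hp, hρp_α⟩) hnotj
    · exact R7a.permType_of_rankOne_absent A ρp ρm _ hR (Or.inl ⟨by rw [hρp_β]; exact hq i, hρm_β i⟩) hnotj

end FreeCount

end R8
end Summit.ValiantsHypothesis.ValiantsHypothesis.Theorems.NewtonUnitEquations.TwoProducts.PermutationType

end
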